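import Summits.ABC.IUTFork.Joshi.ArithmeticoidCohomology
import Summits.ABC.IUTFork.Joshi.ThetaEvaluationCollation

/-!
# Joshi, *Arithmetic Teichmüller Spaces II½* (arXiv:2305.10398v12) §7.4–7.6: AMPHORICITY of the cohomology of an
# arithmeticoid (Prop. 7.4.1), COLLATION of cohomology classes (Prop. 7.5.1, Rmk. 7.5.2), the Tate class (7.6.2) — TYPED,
# nothing asserted

Record file of the abc-iut cell, branch E «type Joshi's construction, test vs S» (rung LADDER-ABC:A2.E; seat abc-iut-E-t38,
slot T-38; node ids J2h:Prop7.4.1, Prop7.5.1, Rmk7.5.2, Rmk7.6.3 of plan/E/JOSHI-DAG.tsv + (7.6.1)/(7.6.2); sequel of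
`Joshi/ArithmeticoidCohomology.lean`, whose carriers and conventions are in force). SOURCE: K. Joshi, *Construction of
Arithmetic Teichmüller Spaces II½: Deformations of Number Fields*, arXiv:2305.10398**v12** (24 Feb 2025; «Preliminary version
for comments», UNREFEREED; bib `Joshi2023ATS2half` = «[Joshi, 2023a]» of [J-III] = arXiv:2401.13508). Locators «p.N l.M» =
line M of page file `pNNNN.txt` of `HOME/plan/repair/lit/renders/Joshi-arxiv-2305.10398-ATS2half/`; [J-I] = arXiv:2106.11452v4
(render `HOME/plan/repair/lit/renders/Joshi-ATS1-2106.11452v4-PDFpaged-book-anonnd/`). **No side is taken** on [IUTchIII]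
Cor. 3.12, on Joshi's claims, or on Mochizuki's report on them (bib `Mochizuki2024JoshiReport`); typed ≠ proved; typed AS A
CANDIDATE ≠ endorsed; print's assertions are `@[claim "Joshi2023ATS2half" "disputed"] def … : Prop`, never axioms,
instances, `sorry` or Literature facts; what FOLLOWS from the signature is proved.

WHY THIS BLOCK IS ON THE S-SPINE. [J-III] Prop. 9.7.5.1 (p.112 l.40–63) — the collation that DEFINES Joshi's reading of
Mochizuki's theta-values set `Θ̃^𝓘_Mochizuki` (Thm-Def. 9.8.1.1) — takes «the images of ξ_{y,a} … under all (topological)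
isomorphisms H¹_e(arith(L′)_y, ℤ(1)) ≃ H¹_e(arith(L′)_{y₀}, ℤ(1)) given by [Joshi, 2023a, Proposition 7.4.1]» and is «proved
exactly as [Joshi, 2023a, Proposition 7.5.1]»; Rmk. 7.6.3 (3) (p.50 l.33–37) says it in Joshi's words: «In [Mochizuki, 2021c,
Corollary 3.12] (detailed in [Joshi, 2024]), one applies Proposition 7.5.1 to collate these crystalline classes arising from a
suitable set of arithmeticoids … to arrive at Mochizuki's theta-values set i.e. the set on the left hand side of [Mochizuki,
2021c, Corollary 3.12] and the said corollary provides a lower bound on the (suitably defined) volume of this set» (an E6 /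
dictionary-row D-11 LOCATOR; quoted, not adjudicated). Which isomorphisms Prop. 7.4.1 «provides» is therefore exactly what the
cell's dictionary row D-10 («collation isomorphisms ↦ ⟨(Ind1) ∪ (Ind2)⟩», the second half of the residual `AnsatzWithinInd`)
must compare with OUR indeterminacy families. Print admits two readings; this file types BOTH, side by side, with the inclusion
between them PROVED and nothing adjudicated:
* reading **N** («provided»): the isomorphisms INDUCED BY ANABELOMORPHISMS, i.e. by isomorphisms of topological groups
  `G_{L_v;K_{y,v}} ≃ G_{L_v;K_{y₀,v}}` through the functoriality of [J-I] Thm. 8.4.1 (1) (`CohomologyDatum.coh`) — what the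
  PROOF of Prop. 7.4.1 (p.48 l.43–46 «one reduces to the local case … it is sufficient to invoke [Joshi, 2021a, Theorem 8.4.1]
  for each factor») and [J-I] Cor. 8.5.1 (p.46 l.22–26 «the union of the images … under all the isomorphisms provided by
  Theorem 8.4.1(2)») produce — `CohomologyDatum.providedIsos`;
* reading **W** («all»): «all the isomorphisms (of topological groups) of each factor» (Prop. 7.5.1, p.49 l.8–10, literal)
  — `allTopIsos`.
`providedIsos_subset_allTopIsos`, `collationProvided_subset_collationAll`. OUR-SIDE ANALOGUE (recorded, NOT bound — E-PLAN
R14: only `Joshi/Dictionary*.lean` / `Joshi/Test*.lean` import the frozen `Cor312*`/`Thm311*` files): reading N is shaped like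
Mochizuki's (Ind1) (`Summit.ABC.IUTFork.Thm311.LogShells.Ind1Family`: automorphisms induced by isomorphs of the étale-like
`G_v`-data); S = `Summit.ABC.IUTFork.Cor312Vol.PilotKummerIndRelated` quantifies «∃ D′ ∈ S.RLGP P.n» = an orbit under
`Subgroup.closure (Ind1Family ∪ Ind2Family)`; Joshi's `Ψ_{X,A}` is likewise an ORBIT of the given classes under a factorwise
isomorphism FAMILY — IndTranslate-SHAPED (E-PLAN R1), but no TEST-CANDIDATE arises from this block alone. The collation is typed
GENERICALLY over a place-indexed family of sorts and an arbitrary factorwise isomorphism family `F`, so that E-t21's [J-III]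
Prop. 9.7.5.1 carrier `ATS3.ClassCollationDatum.iso : ∀ y w, Set (H y w ≃ H std w)` (`Joshi/ThetaEvaluationCollation.lean`,
imported) is `fun y w => F w (y w) (y₀ w)` — §3 builds that datum in both readings and identifies E-t21's `collationSlot` with
the collation typed here (`collationSlot_classCollationDatumN/W`, PROVED). READING FLAGS for E-ref in the docstrings of `LocalGaloisIsomorphic` (print cites Cor. 4.6.1,
which is about actions on `B_L`), `Prop741` («amphoric» typed via (2)+(3)), `Prop751`, `qCoh` (coefficient slip between
(7.6.1) and (7.6.2)). Rmk. 7.6.3 (1)–(2) (p.50 l.24–32: [J-III] applies the principle to crystalline classes of a Tate curve at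
odd semistable primes; such classes are «required») are prose — quoted here, not typed. Standard axioms only; sorry-free.
[claim: Joshi2023ATS2half, status: disputed]
-/

set_option autoImplicit false

noncomputable section

open Set
open scoped TensorProduct

namespace Summit.ABC.IUTFork.Joshi.ATS2half

universe u

/-! ## 1. Prop. 7.4.1 (amphoricity) and Prop. 7.5.1 (collation); Rmk. 7.5.2 (J2h:Prop7.4.1, Prop7.5.1, Rmk7.5.2) -/

section Collation

variable {V : Type u} {Pt : V → Type u}

/-- **COLLATION along a factorwise isomorphism family** — the construction of Prop. 7.5.1 (p.49 l.6–11: «a subset Ψ_{X,A} ⊆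
H^1(arith(L)_{y₀}, ℤ(1)) which consists of the union, over y ∈ A, of the images of all the subsets Ψ_y under all the
isomorphisms (of topological groups) OF EACH FACTOR of H^1(arith(L)_y, ℤ(1)) ≃ H^1(arith(L)_{y₀}, ℤ(1)) provided by Proposition
7.4.1») and of [J-I] Cor. 8.5.1 (p.46 l.22–26), GENERIC over a place-indexed family of sorts `T v y_v` (Rmk. 7.5.2: any
coefficients) and over WHICH factorwise isomorphisms are allowed, `F v a b ⊆ (T v a ≃ T v b)`: the set of all `(e_v(c_v))_v`
with `y ∈ A`, `c ∈ Ψ_y`, and `e_v ∈ F v y_v y₀,v` chosen independently for each place `v`. (E-t21's [J-III] Prop. 9.7.5.1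
carrier `ATS3.ClassCollationDatum.iso : ∀ y w, Set (H y w ≃ H std w)` is `fun y w => F w (y w) (y₀ w)`, §3.) [claim: Joshi2023ATS2half,
status: disputed] -/
def collation (T : (v : V) → Pt v → Type u) (F : ∀ v (a b : Pt v), Set (T v a ≃ T v b)) (y₀ : ∀ v, Pt v)
    (A : Set (∀ v, Pt v)) (Ψ : ∀ y : (∀ v, Pt v), Set (∀ v, T v (y v))) : Set (∀ v, T v (y₀ v)) :=
  {c' | ∃ y ∈ A, ∃ c ∈ Ψ y, ∃ e : ∀ v, T v (y v) ≃ T v (y₀ v), (∀ v, e v ∈ F v (y v) (y₀ v)) ∧ ∀ v, c' v = e v (c v)}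

variable {T : (v : V) → Pt v → Type u} {F F' : ∀ v (a b : Pt v), Set (T v a ≃ T v b)} {y₀ : ∀ v, Pt v}
  {A A' : Set (∀ v, Pt v)} {Ψ Ψ' : ∀ y : (∀ v, Pt v), Set (∀ v, T v (y v))}

/-- The image of `Ψ_y` (`y ∈ A`) under an allowed factorwise isomorphism lies in the collation (the defining clause).
[claim: Joshi2023ATS2half, status: disputed] -/
theorem translate_mem_collation {y : ∀ v, Pt v} (hy : y ∈ A) {c : ∀ v, T v (y v)} (hc : c ∈ Ψ y)
    (e : ∀ v, T v (y v) ≃ T v (y₀ v)) (he : ∀ v, e v ∈ F v (y v) (y₀ v)) :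
    (fun v => e v (c v)) ∈ collation T F y₀ A Ψ :=
  ⟨y, hy, c, hc, e, he, fun _ => rfl⟩

/-- Collation is MONOTONE IN THE ISOMORPHISM FAMILY: allowing more factorwise isomorphisms enlarges `Ψ_{X,A}` (the comparison
lemma between the two readings below). [claim: Joshi2023ATS2half, status: disputed] -/
theorem collation_mono_family (h : ∀ v (a b : Pt v), F v a b ⊆ F' v a b) :
    collation T F y₀ A Ψ ⊆ collation T F' y₀ A Ψ := by
  rintro c' ⟨y, hy, c, hc, e, he, hc'⟩
  exact ⟨y, hy, c, hc, e, fun v => h v _ _ (he v), hc'⟩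

/-- Collation is monotone in the collection `A` of arithmeticoids. [claim: Joshi2023ATS2half, status: disputed] -/
theorem collation_mono_index (h : A ⊆ A') : collation T F y₀ A Ψ ⊆ collation T F y₀ A' Ψ := by
  rintro c' ⟨y, hy, c, hc, e, he, hc'⟩
  exact ⟨y, h hy, c, hc, e, he, hc'⟩

/-- Collation is monotone in the classes `Ψ_y`. [claim: Joshi2023ATS2half, status: disputed] -/
theorem collation_mono_classes (h : ∀ y, Ψ y ⊆ Ψ' y) : collation T F y₀ A Ψ ⊆ collation T F y₀ A Ψ' := by
  rintro c' ⟨y, hy, c, hc, e, he, hc'⟩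
  exact ⟨y, hy, c, h y hc, e, he, hc'⟩

/-- If `y₀ ∈ A` and the identity is an allowed isomorphism at every factor, the standard arithmeticoid's own classes lie in the
collation unchanged. [claim: Joshi2023ATS2half, status: disputed] -/
theorem subset_collation_of_refl (hy₀ : y₀ ∈ A) (hrefl : ∀ v, Equiv.refl (T v (y₀ v)) ∈ F v (y₀ v) (y₀ v)) :
    Ψ y₀ ⊆ collation T F y₀ A Ψ := fun c hc =>
  ⟨y₀, hy₀, c, hc, fun _ => Equiv.refl _, hrefl, fun _ => rfl⟩

/-- The collation over the empty collection is empty. [claim: Joshi2023ATS2half, status: disputed] -/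
theorem collation_empty : collation T F y₀ ∅ Ψ = ∅ := by
  ext c'
  simp [collation]

/-- **Rmk. 7.5.2** (p.49 l.13–14): «One can formulate a similar assertion for coefficients ℤ_p(1), ℚ_p(1) (for p ∈ V_ℚ) etc.» —
DERIVED by genericity: restricting the product to a set of places `P` (e.g. `{v : p_v = p}`) is the collation of the restricted
family. [claim: Joshi2023ATS2half, status: disputed] -/
def collationAt (P : Set V) (T : (v : V) → Pt v → Type u) (F : ∀ v (a b : Pt v), Set (T v a ≃ T v b)) (y₀ : ∀ v, Pt v)
    (A : Set (∀ v, Pt v)) (Ψ : ∀ y : (∀ v, Pt v), Set (∀ v : P, T v (y v))) : Set (∀ v : P, T v (y₀ v)) :=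
  {c' | ∃ y ∈ A, ∃ c ∈ Ψ y, ∃ e : ∀ v : P, T v (y v) ≃ T v (y₀ v),
    (∀ v : P, e v ∈ F v (y v) (y₀ v)) ∧ ∀ v : P, c' v = e v (c v)}

/-- Restricting a collated class to the places in `P` lands in the restricted collation of the restricted classes.
[claim: Joshi2023ATS2half, status: disputed] -/
theorem restrict_mem_collationAt (P : Set V) {c' : ∀ v, T v (y₀ v)} (hc' : c' ∈ collation T F y₀ A Ψ) :
    (fun v : P => c' v) ∈ collationAt P T F y₀ A (fun y => (fun c => fun v : P => c v) '' Ψ y) := by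
  obtain ⟨y, hy, c, hc, e, he, h⟩ := hc'
  exact ⟨y, hy, fun v : P => c v, ⟨c, hc, rfl⟩, fun v : P => e v, fun v => he v, fun v => h v⟩

variable (H : ℕ → (v : V) → Pt v → Type u) [∀ i v y, CommGroup (H i v y)] [∀ i v y, TopologicalSpace (H i v y)]
variable {IsArc : Set V} {G : (v : V) → Pt v → Type u} [∀ v y, Group (G v y)] [∀ v y, TopologicalSpace (G v y)]

/-- **Reading W — «all the isomorphisms (of topological groups) of each factor»** (Prop. 7.5.1, p.49 l.8–10, literal): at the
factor `v`, every group isomorphism `H i v a ≃ H i v b` that is a homeomorphism. [claim: Joshi2023ATS2half, status: disputed] -/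
def allTopIsos (i : ℕ) (v : V) (a b : Pt v) : Set (H i v a ≃ H i v b) :=
  {e | Continuous e ∧ Continuous e.symm ∧ ∀ x x', e (x * x') = e x * e x'}

variable {H}

/-- **Reading N — the isomorphisms «provided by Proposition 7.4.1»** through its proof (p.48 l.43–46) and [J-I] Cor. 8.5.1
(«under all the isomorphisms provided by Theorem 8.4.1(2)», [J-I] p.46 l.22–26): at the factor `v`, the isomorphisms INDUCED
(via `coh`, [J-I] Thm. 8.4.1 (1)) by the anabelomorphisms `G_{L_v;K_a} ≃ₜ* G_{L_v;K_b}`. OUR nearest object (not bound):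
`Summit.ABC.IUTFork.Thm311.LogShells.Ind1Family` (Mochizuki's (Ind1): automorphisms induced by isomorphs of the `G_v`-data).
[claim: Joshi2023ATS2half, status: disputed] -/
def CohomologyDatum.providedIsos (𝔠 : CohomologyDatum H IsArc G) (i : ℕ) (v : V) (a b : Pt v) : Set (H i v a ≃ H i v b) :=
  Set.range fun α : G v a ≃ₜ* G v b => (𝔠.coh i v a b α).toMulEquiv.toEquiv

/-- **N ⊆ W**: every isomorphism induced by an anabelomorphism is an isomorphism of topological groups of that factor — the
only relation between the two readings this file asserts (PROVED). [claim: Joshi2023ATS2half, status: disputed] -/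
theorem CohomologyDatum.providedIsos_subset_allTopIsos (𝔠 : CohomologyDatum H IsArc G) (i : ℕ) (v : V) (a b : Pt v) :
    𝔠.providedIsos i v a b ⊆ allTopIsos H i v a b := by
  rintro e ⟨α, rfl⟩
  exact ⟨(𝔠.coh i v a b α).continuous_toFun, (𝔠.coh i v a b α).continuous_invFun,
    fun x x' => (𝔠.coh i v a b α).map_mul x x'⟩

/-- **The reduction step of the proof of Prop. 7.4.1, typed** (p.48 l.43–44): «The isomorphism class of G_L determines, by
Corollary 4.6.1, the isomorphism class of G_L and the isomorphism class of each of its factors G_{L_v}, so one reduces to the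
local case» — for any two arithmeticoids the local Galois groups at each place are isomorphic topological groups (both are
absolute Galois groups of `L_v`, computed in the algebraic closures `L̄_v ⊂ K_{y_i,v}`, Prop. 4.8.3 (4) p.29 l.27–28). READING
FLAG (E-ref): print's citation «Corollary 4.6.1» is about the actions of `G_L`, `L^*`, `Aut(𝔾(𝒪_{F_v}))` on `B_L` (p.27
l.26–37), not about isomorphism classes of Galois groups; typed as the sentence reads. HYPOTHESIS (claim).
[claim: Joshi2023ATS2half, status: disputed] -/
@[claim "Joshi2023ATS2half" "disputed"]
def LocalGaloisIsomorphic (G : (v : V) → Pt v → Type u) [∀ v y, Group (G v y)] [∀ v y, TopologicalSpace (G v y)] : Prop :=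
  ∀ v (a b : Pt v), Nonempty (G v a ≃ₜ* G v b)

/-- **[J-I] Thm. 8.4.1 (2), as used for Prop. 7.4.1 (3)** ([J-I] v4 p.45 l.58–65: «a similar isomorphism holds for the
subgroups (resp. subspaces) H^1_e, H^1_f, H^1_g of these groups», proof p.46 l.4–5 «noting that these subgroups (resp.
subspaces) are amphoric»): the induced isomorphisms carry the Fontaine subspace at `a` exactly onto the one at `b`. HYPOTHESIS
(claim; merge-debt E-t1/T-25). [claim: Joshi2023ATS2half, status: disputed] -/
@[claim "Joshi2023ATS2half" "disputed"]
def CohomologyDatum.CohPreservesFontaine (𝔠 : CohomologyDatum H IsArc G) (Hf : ∀ i v (y : Pt v), Subgroup (H i v y)) :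
    Prop :=
  ∀ i v (a b : Pt v) (α : G v a ≃ₜ* G v b) (x : H i v a), x ∈ Hf i v a ↔ 𝔠.coh i v a b α x ∈ Hf i v b

/-- **Prop. 7.4.1** (p.48 l.25–42): «(1) The galois cohomology groups H^i(arith(L)_{y₁}, ℤ(1)), H^i_f(arith(L)_{y₁}, ℤ(1)),
H^i(arith(L)_{y₁}, ℚ(1)), H^i_f(arith(L)_{y₁}, ℚ(1)) are G_L-amphoric. (2) In other words: for all integers i ≥ 0 one has
isomorphism of groups H^i(arith(L)_{y₁}, ℤ(1)) ≃ H^i(arith(L)_{y₂}, ℤ(1)), and H^i(arith(L)_{y₁}, ℚ(1)) ≃ H^i(arith(L)_{y₂}, ℚ(1)),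
(3) and also of the Fontaine subspaces: H^i_f(arith(L)_{y₁}, ℤ(1)) ≃ H^i_f(arith(L)_{y₂}, ℤ(1)), and H^i_f(arith(L)_{y₁}, ℚ(1)) ≃
H^i_f(arith(L)_{y₂}, ℚ(1)).» Typed, per Joshi's own «In other words», as (2)+(3) for the carrier `H` (instantiate `H` with the
integral or the rational cohomology): for all `y₁, y₂, i` there is a group isomorphism of the adelic groups carrying the
Fontaine subspace of `y₁` onto that of `y₂`. READING FLAG (E-ref): «G_L-amphoric» in (1) (determined by the topological group
`G_L` up to isomorphism) is typed only through (2)+(3). HYPOTHESIS (claim) — and DERIVED below from the two inputs its proof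
names. [claim: Joshi2023ATS2half, status: disputed] -/
@[claim "Joshi2023ATS2half" "disputed"]
def Prop741 (H : ℕ → (v : V) → Pt v → Type u) [∀ i v y, CommGroup (H i v y)] (Hf : ∀ i v (y : Pt v), Subgroup (H i v y)) :
    Prop :=
  ∀ (y₁ y₂ : ∀ v, Pt v) (i : ℕ), ∃ e : CohArith H i y₁ ≃* CohArith H i y₂,
    ∀ c, c ∈ cohArithF H Hf i y₁ ↔ e c ∈ cohArithF H Hf i y₂

/-- **Prop. 7.4.1 (2)+(3) DERIVED along its printed proof** (p.48 l.43–46): local anabelomorphisms exist at every factor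
(`LocalGaloisIsomorphic`), each induces an isomorphism of that factor respecting the Fontaine subspaces ([J-I] Thm. 8.4.1 via
`coh`, `CohPreservesFontaine`), and the factorwise isomorphisms assemble into an isomorphism of the products
(`MulEquiv.piCongrRight`). [claim: Joshi2023ATS2half, status: disputed] -/
theorem prop741_of (𝔠 : CohomologyDatum H IsArc G) {Hf : ∀ i v (y : Pt v), Subgroup (H i v y)}
    (hG : LocalGaloisIsomorphic G) (hf : 𝔠.CohPreservesFontaine Hf) : Prop741 H Hf := by
  intro y₁ y₂ i
  have α : ∀ v, G v (y₁ v) ≃ₜ* G v (y₂ v) := fun v => Classical.choice (hG v (y₁ v) (y₂ v))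
  refine ⟨MulEquiv.piCongrRight fun v => (𝔠.coh i v (y₁ v) (y₂ v) (α v)).toMulEquiv, fun c => ?_⟩
  rw [mem_cohArithF_iff, mem_cohArithF_iff]
  exact forall_congr' fun v => hf i v (y₁ v) (y₂ v) (α v) (c v)

/-- Under `LocalGaloisIsomorphic`, reading N is inhabited at every factor (so the collation along N of a nonempty `Ψ_y`,
`y ∈ A`, is nonempty). [claim: Joshi2023ATS2half, status: disputed] -/
theorem CohomologyDatum.providedIsos_nonempty (𝔠 : CohomologyDatum H IsArc G) (hG : LocalGaloisIsomorphic G) (i : ℕ) (v : V)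
    (a b : Pt v) : (𝔠.providedIsos i v a b).Nonempty :=
  let ⟨α⟩ := hG v a b
  ⟨_, α, rfl⟩

/-- **`Ψ_{X,A}` in reading N**: the collation (Prop. 7.5.1) of classes `Ψ_y ⊆ H^i(arith(L)_y, ·)`, `y ∈ A`, into the
cohomology of the standard arithmeticoid `y₀ = 𝔠.std` along the isomorphisms induced by anabelomorphisms.
[claim: Joshi2023ATS2half, status: disputed] -/
def CohomologyDatum.collationProvided (𝔠 : CohomologyDatum H IsArc G) (i : ℕ) (A : Set (∀ v, Pt v))
    (Ψ : ∀ y : (∀ v, Pt v), Set (CohArith H i y)) : Set (CohArith H i 𝔠.std) :=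
  collation (H i) (𝔠.providedIsos i) 𝔠.std A Ψ

/-- **`Ψ_{X,A}` in reading W**: the collation along all isomorphisms of topological groups of each factor (Prop. 7.5.1
literal). [claim: Joshi2023ATS2half, status: disputed] -/
def CohomologyDatum.collationAll (𝔠 : CohomologyDatum H IsArc G) (i : ℕ) (A : Set (∀ v, Pt v))
    (Ψ : ∀ y : (∀ v, Pt v), Set (CohArith H i y)) : Set (CohArith H i 𝔠.std) :=
  collation (H i) (allTopIsos H i) 𝔠.std A Ψ

/-- **N-collation ⊆ W-collation** (PROVED; the two readings are otherwise left side by side). [claim: Joshi2023ATS2half,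
status: disputed] -/
theorem CohomologyDatum.collationProvided_subset_collationAll (𝔠 : CohomologyDatum H IsArc G) (i : ℕ) (A : Set (∀ v, Pt v))
    (Ψ : ∀ y : (∀ v, Pt v), Set (CohArith H i y)) : 𝔠.collationProvided i A Ψ ⊆ 𝔠.collationAll i A Ψ :=
  collation_mono_family fun v a b => 𝔠.providedIsos_subset_allTopIsos i v a b

/-- The identity is always a W-isomorphism, so with `y₀ ∈ A` the standard classes lie in the W-collation unchanged.
[claim: Joshi2023ATS2half, status: disputed] -/
theorem CohomologyDatum.subset_collationAll (𝔠 : CohomologyDatum H IsArc G) (i : ℕ) {A : Set (∀ v, Pt v)}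
    (Ψ : ∀ y : (∀ v, Pt v), Set (CohArith H i y)) (h : 𝔠.std ∈ A) : Ψ 𝔠.std ⊆ 𝔠.collationAll i A Ψ :=
  subset_collation_of_refl h fun _ => ⟨continuous_id, continuous_id, fun _ _ => rfl⟩

/-- **Prop. 7.5.1** (p.48 l.50–p.49 l.12): «Let X/L be a geometrically connected, smooth, quasi-projective variety over L. Let
A ⊂ 𝒴_L be a collection of arithmeticoids and write A_X = {X/arith(L)_y : y ∈ A} for the collection of holomorphoids of X/L
provided by the arithmeticoids in A. For each holomorphoid X/arith(L)_y ∈ A_X let Ψ_y ⊆ H^1(arith(L)_y, ℤ(1)) be a collection of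
cohomology classes arising from X/arith(L)_y (for example one can take Ψ_y = {q_{C/arith(L)_y}} constructed in (7.6.2)). Let y₀
be the standard arithmeticoid defined by §7.1. Then there exists a subset Ψ_{X,A} ⊆ H^1(arith(L)_{y₀}, ℤ(1)) which consists of
the union, over y ∈ A, of the images of all the subsets Ψ_y under all the isomorphisms (of topological groups) of each factor of
H^1(arith(L)_y, ℤ(1)) ≃ H^1(arith(L)_{y₀}, ℤ(1)) provided by Proposition 7.4.1.» («Proof. The proof is clear from [Joshi, 2021a,
Corollary 8.5.1].») Typed as the existence of the set, for either reading of the allowed isomorphisms — an assertion that is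
TRUE BY DEFINITION (`prop751_holds`): the content of the item is the family of isomorphisms, typed above. (The holomorphoids
`A_X` enter only through their arithmeticoids `y`.) [claim: Joshi2023ATS2half, status: disputed] -/
@[claim "Joshi2023ATS2half" "disputed"]
def Prop751 (𝔠 : CohomologyDatum H IsArc G) : Prop :=
  ∀ (A : Set (∀ v, Pt v)) (Ψ : ∀ y : (∀ v, Pt v), Set (CohArith H 1 y)),
    (∃ ΨN : Set (CohArith H 1 𝔠.std), ∀ c', c' ∈ ΨN ↔ ∃ y ∈ A, ∃ c ∈ Ψ y, ∃ e : ∀ v, H 1 v (y v) ≃ H 1 v (𝔠.std v),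
      (∀ v, e v ∈ 𝔠.providedIsos 1 v (y v) (𝔠.std v)) ∧ ∀ v, c' v = e v (c v)) ∧
    (∃ ΨW : Set (CohArith H 1 𝔠.std), ∀ c', c' ∈ ΨW ↔ ∃ y ∈ A, ∃ c ∈ Ψ y, ∃ e : ∀ v, H 1 v (y v) ≃ H 1 v (𝔠.std v),
      (∀ v, e v ∈ allTopIsos H 1 v (y v) (𝔠.std v)) ∧ ∀ v, c' v = e v (c v))

/-- **Prop. 7.5.1 HOLDS** — the sets are `collationProvided` and `collationAll` (DISCHARGED: existence of a set so described
is definitional). [claim: Joshi2023ATS2half, status: disputed] -/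
theorem prop751_holds (𝔠 : CohomologyDatum H IsArc G) : Prop751 𝔠 := fun A Ψ =>
  ⟨⟨𝔠.collationProvided 1 A Ψ, fun _ => Iff.rfl⟩, ⟨𝔠.collationAll 1 A Ψ, fun _ => Iff.rfl⟩⟩

end Collation

/-! ## 2. §7.6: the worked example — the cohomology class of a Tate elliptic curve ((7.6.1), (7.6.2)) -/

section TateClass

variable {V : Type u} {Pt : V → Type u} (IsArc : Set V) (Lv : V → Type u) [∀ v, NormedField (Lv v)]
variable (H1 : (v : V) → Pt v → Type u) [∀ v y, CommGroup (H1 v y)]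

/-- **§7.6, the data of the worked example** (p.49 l.15–p.50 l.18): «Let C/arith(L)_y be an elliptic curve over an
arithmeticoid of L. Let v₁, …, v_n be the non-archimedean primes of L at which [C] has semi-stable reduction … at each v_j one
obtains a Tate elliptic curve and hence a Galois cohomology class … given by the Tate parameter q_{v_j} … Take a compatible
system {(q_{v_j})^{1/p^n}}_{n≥0} of p^n-th roots in L̄_v of q_{v_j} ∈ L_v. This provides a Galois cohomology class … [Berger, 2002,
II.4] or [Fargues and Fontaine, 2018, Chapitre 10] … At any archimedean prime v one can take the Schottky parameter q_v ∈
Ext^1(ℤ(0), ℤ(1)) (see §10.7)». SIGNATURE: the finitely many semistable places, the Tate parameters `q_{v_j} ∈ L_{v_j}^×`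
(`‖q‖ < 1`), and the archimedean Schottky classes. [claim: Joshi2023ATS2half, status: disputed] -/
structure TateCurveDatum where
  /-- `v₁, …, v_n`: the non-archimedean places of semistable (bad) reduction -/
  semistable : Finset V
  /-- they are non-archimedean -/
  semistable_nonarc : ∀ v ∈ semistable, v ∉ IsArc
  /-- the Tate parameter `q_{v_j} ∈ L_{v_j}^×` -/
  q : ∀ v, v ∈ semistable → (Lv v)ˣ
  /-- `|q_{v_j}| < 1` -/
  norm_q_lt_one : ∀ v (hv : v ∈ semistable), ‖(q v hv : Lv v)‖ < 1
  /-- the Schottky-parameter class `q_v ∈ Ext^1_{MHS}(ℤ(0),ℤ(1))` at an archimedean place -/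
  qArc : ∀ v, v ∈ IsArc → ∀ y : Pt v, H1 v y

variable {IsArc Lv H1}

/-- **(7.6.1)/(7.6.2): the class `q_{C,y} ∈ H^1(arith(L)_y, ℤ(1))`** (p.50 l.1–20): «q^{coh}_{C,y,v} = 1 ∈ H^1(G_{L_v}, ℤ_{p_v}(1))
if v ∈ V^non_L, and v ≠ v₁, …, v_n; {(q_{v_j})^{1/p^n}}_{n≥0} ∈ H^1(G_{L_v}, ℚ_{p_v}(1)) if v = v_j for j = 1, …, n; q_v ∈
Ext^1_{MHS}(ℤ(0), ℤ(1)) if v ∈ V^arc_L. Thus one obtains a well-define element (7.6.2) q_{C,y} ∈ H^1(arith(L)_y, ℤ(1)).» DERIVED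
over the signature, the semistable component being the image of `q_{v_j}` under the Kummer map `kum` of Prop. 7.2.2 (2).
READING FLAG (E-ref): print places the semistable component in `H^1(G_{L_v}, ℚ_{p_v}(1))` in (7.6.1) but the assembled class in
the INTEGRAL group in (7.6.2); typed integrally (the Kummer class of `q ∈ L_v^×` is integral by Prop. 7.2.2 (2)). OUR nearest
object (not bound): the `q`-pilot Kummer datum `qK` / `Summit.ABC.IUTFork.Cor312.Setting.qPilot` at bad places; [J-III]
(9.7.4.2) replaces `q` by the one-unit `1 + p*·q^{1/2ℓ}` (E-t21). [claim: Joshi2023ATS2half, status: disputed] -/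
def qCoh [DecidableEq V] [DecidablePred (· ∈ IsArc)] (kum : ∀ v (y : Pt v), (Lv v)ˣ →* H1 v y)
    (C : TateCurveDatum IsArc Lv H1) (y : ∀ v, Pt v) : ∀ v, H1 v (y v) := fun v =>
  if hv : v ∈ C.semistable then kum v (y v) (C.q v hv)
  else if ha : v ∈ IsArc then C.qArc v ha (y v) else 1

variable [DecidableEq V] [DecidablePred (· ∈ IsArc)] (kum : ∀ v (y : Pt v), (Lv v)ˣ →* H1 v y)
  (C : TateCurveDatum IsArc Lv H1) (y : ∀ v, Pt v)

/-- (7.6.1), semistable case: the component of `q_{C,y}` at `v_j` is the Kummer class of `q_{v_j}`.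
[claim: Joshi2023ATS2half, status: disputed] -/
theorem qCoh_of_mem_semistable {v : V} (hv : v ∈ C.semistable) : qCoh kum C y v = kum v (y v) (C.q v hv) := by
  simp [qCoh, dif_pos hv]

/-- (7.6.1), archimedean case: the component is the Schottky class. [claim: Joshi2023ATS2half, status: disputed] -/
theorem qCoh_of_arc {v : V} (ha : v ∈ IsArc) : qCoh kum C y v = C.qArc v ha (y v) := by
  have hv : v ∉ C.semistable := fun h => C.semistable_nonarc v h ha
  simp [qCoh, dif_neg hv, dif_pos ha]

/-- (7.6.1), remaining case: at a non-archimedean place of good reduction the component is the trivial class `1` (written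
multiplicatively). [claim: Joshi2023ATS2half, status: disputed] -/
theorem qCoh_of_good {v : V} (hv : v ∉ C.semistable) (ha : v ∉ IsArc) : qCoh kum C y v = 1 := by
  simp [qCoh, dif_neg hv, dif_neg ha]

/-- Prop. 7.5.1's example («one can take Ψ_y = {q_{C/arith(L)_y}}», p.49 l.4–5): collating the singletons `{q_{C,y}}`, any
allowed factorwise translate of `q_{C,y}` (`y ∈ A`) is a member of `Ψ_{X,A}`. [claim: Joshi2023ATS2half, status: disputed] -/
theorem qCoh_translate_mem_collation (F : ∀ v (a b : Pt v), Set (H1 v a ≃ H1 v b)) (y₀ : ∀ v, Pt v) {A : Set (∀ v, Pt v)}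
    (hy : y ∈ A) (e : ∀ v, H1 v (y v) ≃ H1 v (y₀ v)) (he : ∀ v, e v ∈ F v (y v) (y₀ v)) :
    (fun v => e v (qCoh kum C y v)) ∈ collation H1 F y₀ A (fun y' => {qCoh kum C y'}) :=
  translate_mem_collation hy rfl e he

end TateClass

/-! ## 3. Bridge to [J-III] Prop. 9.7.5.1 as typed by E-t21 (`ATS3.ClassCollationDatum`, `Joshi/ThetaEvaluationCollation.lean`) -/

section BridgeATS3

variable {V : Type u} {Pt : V → Type u} {H : ℕ → (v : V) → Pt v → Type u} [∀ i v y, CommGroup (H i v y)]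
  [∀ i v y, TopologicalSpace (H i v y)] {IsArc : Set V} {G : (v : V) → Pt v → Type u} [∀ v y, Group (G v y)]
  [∀ v y, TopologicalSpace (G v y)]

/-- The [J-III] Prop. 9.7.5.1 collation datum («all (topological) isomorphisms … given by [Joshi, 2023a, Proposition 7.4.1]»,
[J-III] p.112 l.65–70; E-t21's `ATS3.ClassCollationDatum`: holomorphoids labelled by their arithmeticoids `y : ∀ v, Pt v`,
factors `H i v (y v)`, standard point `y₀`) in READING N: admissible factorwise isomorphisms = those induced by anabelomorphisms.
[claim: Joshi2023ATS2half, status: disputed] -/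
def CohomologyDatum.classCollationDatumN (𝔠 : CohomologyDatum H IsArc G) (i : ℕ) :
    ATS3.ClassCollationDatum (∀ v, Pt v) V (fun y v => H i v (y v)) where
  std := 𝔠.std
  iso y v := 𝔠.providedIsos i v (y v) (𝔠.std v)

/-- The same datum in READING W: all isomorphisms of topological groups of each factor. [claim: Joshi2023ATS2half,
status: disputed] -/
def CohomologyDatum.classCollationDatumW (𝔠 : CohomologyDatum H IsArc G) (i : ℕ) :
    ATS3.ClassCollationDatum (∀ v, Pt v) V (fun y v => H i v (y v)) where
  std := 𝔠.std
  iso y v := allTopIsos H i v (y v) (𝔠.std v)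

/-- **[J-II½] Prop. 7.5.1 ↔ [J-III] Prop. 9.7.5.1 (reading N), PROVED**: E-t21's slot `Ψ_Σ,a` of the classes `ξ_{y,a}`,
`y ∈ Σ`, over the N-datum IS the collation typed here of the singletons `{ξ_{y,a}}` ([J-III] p.112 l.70: «proved exactly as
[Joshi, 2023a, Proposition 7.5.1]»). [claim: Joshi2023ATS2half, status: disputed] -/
theorem collationSlot_classCollationDatumN (𝔠 : CohomologyDatum H IsArc G) (i : ℕ) (Hol : Set (∀ v, Pt v)) {A : Type u}
    (ξ : ∀ y : (∀ v, Pt v), A → ∀ v, H i v (y v)) (a : A) :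
    (𝔠.classCollationDatumN i).collationSlot Hol ξ a = 𝔠.collationProvided i Hol fun y => {ξ y a} := by
  ext x
  unfold ATS3.ClassCollationDatum.collationSlot CohomologyDatum.collationProvided collation
  simp only [Set.mem_setOf_eq, Set.mem_singleton_iff]
  constructor
  · rintro ⟨y, hy, φ, hφ, hx⟩
    exact ⟨y, hy, ξ y a, rfl, φ, hφ, hx⟩
  · rintro ⟨y, hy, c, rfl, e, he, hx⟩
    exact ⟨y, hy, e, he, hx⟩

/-- The same identification in reading W. [claim: Joshi2023ATS2half, status: disputed] -/
theorem collationSlot_classCollationDatumW (𝔠 : CohomologyDatum H IsArc G) (i : ℕ) (Hol : Set (∀ v, Pt v)) {A : Type u}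
    (ξ : ∀ y : (∀ v, Pt v), A → ∀ v, H i v (y v)) (a : A) :
    (𝔠.classCollationDatumW i).collationSlot Hol ξ a = 𝔠.collationAll i Hol fun y => {ξ y a} := by
  ext x
  unfold ATS3.ClassCollationDatum.collationSlot CohomologyDatum.collationAll collation
  simp only [Set.mem_setOf_eq, Set.mem_singleton_iff]
  constructor
  · rintro ⟨y, hy, φ, hφ, hx⟩
    exact ⟨y, hy, ξ y a, rfl, φ, hφ, hx⟩
  · rintro ⟨y, hy, c, rfl, e, he, hx⟩
    exact ⟨y, hy, e, he, hx⟩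

/-- Hence E-t21's N-collation of any tuple of classes sits inside its W-collation, slot by slot (`collation_mono_family`).
[claim: Joshi2023ATS2half, status: disputed] -/
theorem collationSlot_classCollationDatumN_subset_W (𝔠 : CohomologyDatum H IsArc G) (i : ℕ) (Hol : Set (∀ v, Pt v))
    {A : Type u} (ξ : ∀ y : (∀ v, Pt v), A → ∀ v, H i v (y v)) (a : A) :
    (𝔠.classCollationDatumN i).collationSlot Hol ξ a ⊆ (𝔠.classCollationDatumW i).collationSlot Hol ξ a := by
  rw [collationSlot_classCollationDatumN, collationSlot_classCollationDatumW]
  exact 𝔠.collationProvided_subset_collationAll i Hol _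

end BridgeATS3

end Summit.ABC.IUTFork.Joshi.ATS2half

end
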